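import Mathlib
import Summits.NavierStokesRegularity.NavierStokesRegularity.Theorems.SubOnsagerCeilingOrthantTailCeiling.Negative.OrthantTailCeilingFalseOfSideBranchEscapeEstimate
import HarnessLib

/-!
# `SubOnsagerCeiling.OrthantTailCeiling` (stmt-NavierStokesRegularity-25507) — negative lemma modulo an
# ONSAGER-CRITICAL escape estimate (`SideBranchCriticalEscapeEstimate`)

The two negative lemmas of record for the aside crux `OrthantTailCeiling` (and, by the twin
reduction, for `ForwardTailCeiling`, item 26608) are modulo ANOMALOUS ESCAPE of the side-branch
dead-end table `α_SB = sideBranchTable`: a FIXED fraction `ρE₀` of the energy must leave EVERY block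
of shells `0..K` within a FIXED horizon `T₀` at small viscosity (`SideBranchEscape`, p620932;
`SideBranchEscapeEstimate`, p627307).  This file shrinks that construction debt exponentially.  It
suffices that, at infinitely many depths `K`, the block `0..K` loses the ONSAGER-CRITICAL amount
`c·(1+ε₀)^{-K}·E₀` within SOME horizon `T = T(K)` for all small viscosities
(`SideBranchCriticalEscapeEstimateAt ε₀`; `c > 0` uniform, the datum may depend on `K`; an a priori
estimate universally quantified over regular solutions — nothing to construct):

**`orthantTailCeiling_false_of_sideBranchCriticalEscapeEstimate :
SideBranchCriticalEscapeEstimate → ¬ OrthantTailCeiling`** (BY NAME), together with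
`not_ceilingAt_sideBranch_of_criticalEscapeEstimate` (the per-table body at `α_SB`); the sibling file
`…/Negative/ShellBarrierFalseOfSideBranchCriticalEscapeEstimate.lean` kills the shell barrier and the two
registered stubs of the dead line «shell-barrier» modulo the same hypothesis, and
`sideBranchCriticalEscapeEstimateAt_of_escapeEstimateAt` records that the old hypothesis implies the
new one.

WHY THE WEAKER HYPOTHESIS SUFFICES (the one new idea).  A sub-Onsager ceiling with exponent `θ > 1/2`
and constant `C` does two things along a regular non-negative solution: (i) it bounds the TAIL
between the shells `K+1` and `K'` directly, `Σ_{k=K+1..K'} Σ_i ½X_{i,k}² ≤ C E₀ (1+ε₀)^{-2θ(K+1)}`;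
(ii) by the metering lemmas of record (`sideBranch_noEscape_abstract/_rate`: the dead-end pocket
integrates the side mode, the side mode integrates the chain) the energy leaving the deeper block
`0..K'` is `≤ Φ₁(C,θ,T)·(1+ε₀)^{-(θ-1/2)K'} + 2ν_{K'}E_max T`, which is `o(1)` as `K' → ∞`, `ν → 0`.
Hence the escape from the block `0..K` is at most `C E₀ (1+ε₀)^{-2θ(K+1)} + o(1)`.  An escape of
`c E₀ (1+ε₀)^{-K}` beats this as soon as `C (1+ε₀)^{-(2θ-1)K} < c/4`, i.e. at every large depth,
because `2θ > 1`: the exponent `1` is exactly the Onsager-critical rate, and a fixed fraction is not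
needed.  (Existence of the solutions the estimate talks about is free under the ceiling:
`sideBranch_viscousGlobal_of_ceilingAt` + `viscousGlobal_window`, p627307.)

WHAT REMAINS (honest): a LOWER bound `escape_K(T_K) ≥ c E₀ (1+ε₀)^{-K}` at infinitely many depths for
the Katz–Pavlović conveyor of `α_SB` through its `1/5` side pump — e.g. any inductive cascade bound
losing at most the factor `(1+ε₀)^{-1}` per shell (for `ε₀ = 1`: half) would do; numerically the
conveyor keeps `≈ 10 %` of `E₀` running past every shell (`Cruxes/OrthantTailCeiling/REFUTATION-
EVIDENCE.md` §5), far more than needed.  Not in print for networks with dead ends; not constructed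
here.

HONEST FRAMING: MODEL lattice ODEs only (Tao 2016 §4 vocabulary; rung TL-M2Break); conditional
refutations plus elementary bookkeeping; they settle nothing by themselves; no summit, rung or crux
is proved; nothing here is a statement about the Navier–Stokes equations.
[cite: Tao2016AveragedNS, §4 (4.2)–(4.3), (4.5), (4.8), the viscous equation before Thm. 4.2];
Katz–Pavlović couplings and their positivity: [cite: BarbatoMorandinRomito2011, §2].
-/

noncomputable section

-- the sub-problem namespace `NavierStokesRegularity.NavierStokesRegularity` is the tree's layout (D-0017)
set_option linter.dupNamespace false

namespace Summit.NavierStokesRegularity.NavierStokesRegularity.Theorems.SubOnsagerCeiling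

open Set Filter MeasureTheory intervalIntegral
open scoped Topology
open Literature.Analysis.FluidPDE.TaoCascade
open Summit.NavierStokesRegularity.NavierStokesRegularity.Theses.SubOnsagerCeiling

/-! ## §1 The Onsager-critical escape estimate -/

/-- **`SideBranchCriticalEscapeEstimateAt ε₀` — ONSAGER-CRITICAL A PRIORI ESCAPE ESTIMATE for the
side-branch table at scale ratio `b = 1+ε₀`** (`Prop`; NOTHING asserted; the hypothesis this negative
lemma is modulo).  There is a rate constant `c > 0` such that for INFINITELY MANY depths `K`
(`∀ K₀, ∃ K ≥ K₀`) there are a one-shell datum `X₀` of positive energy `E₀`, a horizon `T > 0` and a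
viscosity threshold `ν₀ > 0` (all allowed to depend on `K`) such that for every `0 < ν ≤ ν₀` some
time `s ∈ (0, T]` has: EVERY regular solution of the `ν`-viscous `α_SB` lattice on `[0, s]` from `X₀`
(one-shell datum, no shells below `0`, Tao's weight bound (4.5), continuous modes, exact viscous
equation within `[0, s]`) has lost at least the Onsager-critical fraction `c·b^{-K}` of its energy
from the block of shells `0..K` by time `s`: `Σ_{k ≤ K} Σ_i ½X_{i,k}(s)² ≤ (1 − c·b^{-K})·E₀`.
Exponentially weaker than `SideBranchEscapeEstimateAt ε₀` (fixed fraction, fixed horizon, all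
depths; `sideBranchCriticalEscapeEstimateAt_of_escapeEstimateAt`).  A CONSTRUCTION TARGET, not a
published fact. [cite: Tao2016AveragedNS, §4 (4.5), the viscous equation before Thm. 4.2] -/
@[conjecture] def SideBranchCriticalEscapeEstimateAt (ε₀ : ℝ) : Prop :=
  ∃ c : ℝ, 0 < c ∧ ∀ K₀ : ℕ, ∃ K : ℕ, K₀ ≤ K ∧
    ∃ X₀ : Fin 4 → ℝ, 0 < (∑ i : Fin 4, (1 / 2 : ℝ) * X₀ i ^ 2) ∧
    ∃ T : ℝ, 0 < T ∧ ∃ ν₀ : ℝ, 0 < ν₀ ∧ ∀ ν : ℝ, 0 < ν → ν ≤ ν₀ → ∃ s : ℝ, 0 < s ∧ s ≤ T ∧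
      ∀ X : Fin 4 → ℤ → ℝ → ℝ,
        (∀ (i : Fin 4) (k : ℤ), X i k 0 = if k = 0 then X₀ i else 0) →
        (∀ (i : Fin 4) (k : ℤ), k < 0 → ∀ t : ℝ, X i k t = 0) →
        (∃ M : ℝ, ∀ (t : ℝ) (i : Fin 4) (k : ℤ), (1 + (1 + ε₀) ^ ((10 : ℝ) * k)) * |X i k t| ≤ M) →
        (∀ (i : Fin 4) (k : ℤ), Continuous (X i k)) →
        (∀ (i : Fin 4) (k : ℤ), ∀ t ∈ Set.Icc (0 : ℝ) s, HasDerivWithinAt (X i k)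
          (quadTerm ε₀ sideBranchTable X i k t - ν * (1 + ε₀) ^ ((2 : ℝ) * k) * X i k t)
          (Set.Icc (0 : ℝ) s) t) →
        (∑ k ∈ Finset.range (K + 1), ∑ i : Fin 4, (1 / 2 : ℝ) * X i (k : ℤ) s ^ 2) ≤
          (1 - c * (1 + ε₀) ^ (-(K : ℝ))) * ∑ i : Fin 4, (1 / 2 : ℝ) * X₀ i ^ 2

/-- `SideBranchCriticalEscapeEstimate`: the Onsager-critical escape estimate at SOME scale ratio
`ε₀ ∈ (0, 1]` (`Prop`; nothing asserted; the `H` of this negative lemma). [this file] -/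
@[conjecture] def SideBranchCriticalEscapeEstimate : Prop :=
  ∃ ε₀ : ℝ, 0 < ε₀ ∧ ε₀ ≤ 1 ∧ SideBranchCriticalEscapeEstimateAt ε₀

/-- **The escape estimate of record implies the Onsager-critical one**: a fixed fraction `ρ` lost
from every block within a fixed horizon is in particular the fraction `ρ·b^{-K} ≤ ρ` lost from the
block `0..K` (`b = 1+ε₀ ≥ 1`). So this file's negative lemma supersedes
`orthantTailCeiling_false_of_sideBranchEscapeEstimate`. [this file] -/
theorem sideBranchCriticalEscapeEstimateAt_of_escapeEstimateAt {ε₀ : ℝ} (hε : 0 ≤ ε₀)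
    (h : SideBranchEscapeEstimateAt ε₀) : SideBranchCriticalEscapeEstimateAt ε₀ := by
  obtain ⟨ρ, hρ, T₀, hT₀, X₀, hE₀, hK⟩ := h
  refine ⟨ρ, hρ, fun K₀ => ?_⟩
  obtain ⟨ν₀, hν₀, hν⟩ := hK K₀
  refine ⟨K₀, le_rfl, X₀, hE₀, T₀, hT₀, ν₀, hν₀, fun ν hνpos hνle => ?_⟩
  obtain ⟨s, hs, hsT, hall⟩ := hν ν hνpos hνle
  refine ⟨s, hs, hsT, fun X hinit hlow hbd hcont hder => ?_⟩
  have h1 := hall X hinit hlow hbd hcont hder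
  have hb1 : (1 : ℝ) ≤ 1 + ε₀ := by linarith
  have hpow : (1 + ε₀) ^ (-(K₀ : ℝ)) ≤ 1 :=
    Real.rpow_le_one_of_one_le_of_nonpos hb1 (by simp)
  have h2 : (1 - ρ) * (∑ i : Fin 4, (1 / 2 : ℝ) * X₀ i ^ 2) ≤
      (1 - ρ * (1 + ε₀) ^ (-(K₀ : ℝ))) * ∑ i : Fin 4, (1 / 2 : ℝ) * X₀ i ^ 2 := by
    apply mul_le_mul_of_nonneg_right _ hE₀.le
    nlinarith
  exact h1.trans h2

/-! ## §2 CEILING ⇒ NO CRITICAL ESCAPE (the quantitative core) -/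

section Solution

variable {ε₀ ν θ C s T : ℝ} {X₀ : Fin 4 → ℝ} {X : Fin 4 → ℤ → ℝ → ℝ}

/-- **Loss of a deep block under a per-shell ceiling (metering of record, packaged).** Along a
regular solution of the `ν`-viscous `α_SB` lattice on `[0,s]` (`0 ≤ ν ≤ 1`, `s ≤ T`) from the one-shell
datum `X₀` (energy `E₀`) that obeys the per-shell ceiling `Σ_i ½X_{i,k}(u)² ≤ C E₀ b^{-2θk}` on `[0,s]`
(`θ > 1/2`), the block of shells `0..K'` (`K' ≥ 1`, `ν b^{2(K'+1)} s ≤ 1`) has lost by time `s` at most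
`Φ₁·b^{-(θ-1/2)K'} + 2ν b^{2K'}·(C E₀ (K'+1))·s`, `Φ₁ = (5 + T/2 + 25e/2 + e)A² + (5e/2)A³ + (5T/2)A`,
`A = √(2CE₀)` (`sideBranch_noEscape_abstract` ∘ `sideBranch_noEscape_rate`). [this file] -/
theorem sideBranch_deepBlockLoss_le_of_shellCeiling (hε : 0 < ε₀) (hν : 0 ≤ ν) (hν1 : ν ≤ 1)
    (hθ : 1 / 2 < θ) (hC : 0 ≤ C)
    (hinit : ∀ (i : Fin 4) (k : ℤ), X i k 0 = if k = 0 then X₀ i else 0)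
    (hlow : ∀ (i : Fin 4) (k : ℤ), k < 0 → ∀ t : ℝ, X i k t = 0)
    (hcont : ∀ (i : Fin 4) (k : ℤ), Continuous (X i k))
    (hder : ∀ (i : Fin 4) (k : ℤ), ∀ t ∈ Icc (0 : ℝ) s, HasDerivWithinAt (X i k)
      (quadTerm ε₀ sideBranchTable X i k t - ν * (1 + ε₀) ^ ((2 : ℝ) * k) * X i k t)
      (Icc (0 : ℝ) s) t)
    (hs : 0 < s) (hsT : s ≤ T)
    (hshell : ∀ u ∈ Icc (0 : ℝ) s, ∀ k : ℕ, ∑ i : Fin 4, (1 / 2 : ℝ) * X i (k : ℤ) u ^ 2 ≤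
      C * (∑ i : Fin 4, (1 / 2 : ℝ) * X₀ i ^ 2) * (1 + ε₀) ^ (-(2 * θ * (k : ℝ))))
    (K' : ℕ) (hK'1 : 1 ≤ K') (hνt : ν * (1 + ε₀) ^ ((2 : ℝ) * ((K' : ℝ) + 1)) * s ≤ 1) :
    (∑ i : Fin 4, (1 / 2 : ℝ) * X₀ i ^ 2) -
        (∑ k ∈ Finset.range (K' + 1), ∑ i : Fin 4, (1 / 2 : ℝ) * X i (k : ℤ) s ^ 2) ≤
      ((5 + T / 2 + 25 * Real.exp 1 / 2 + Real.exp 1) *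
            Real.sqrt (2 * C * ∑ i : Fin 4, (1 / 2 : ℝ) * X₀ i ^ 2) ^ 2 +
          5 * Real.exp 1 / 2 * Real.sqrt (2 * C * ∑ i : Fin 4, (1 / 2 : ℝ) * X₀ i ^ 2) ^ 3 +
          5 * T / 2 * Real.sqrt (2 * C * ∑ i : Fin 4, (1 / 2 : ℝ) * X₀ i ^ 2)) *
          (1 + ε₀) ^ (-((θ - 1 / 2) * (K' : ℝ))) +
        2 * (ν * (1 + ε₀) ^ ((2 : ℝ) * (K' : ℝ))) *
          (C * (∑ i : Fin 4, (1 / 2 : ℝ) * X₀ i ^ 2) * ((K' : ℝ) + 1)) * s := by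
  have hb : (0 : ℝ) < 1 + ε₀ := by linarith
  have hb1 : (1 : ℝ) < 1 + ε₀ := by linarith
  set E₀ : ℝ := ∑ i : Fin 4, (1 / 2 : ℝ) * X₀ i ^ 2 with hE₀def
  have hE₀0 : 0 ≤ E₀ := Finset.sum_nonneg fun i _ => by positivity
  set A : ℝ := Real.sqrt (2 * C * E₀) with hAdef
  have hA0 : 0 ≤ A := Real.sqrt_nonneg _
  set Emax : ℝ := C * E₀ * ((K' : ℝ) + 1) with hEmaxdef
  -- amplitudes under the ceiling
  have habs : ∀ u ∈ Icc (0 : ℝ) s, ∀ (k : ℕ) (i : Fin 4),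
      |X i (k : ℤ) u| ≤ A * (1 + ε₀) ^ (-(θ * (k : ℝ))) :=
    fun u hu k i => sideBranch_abs_le_of_shellCeiling hε hC hE₀0 (hshell u hu k) i
  have hcast : ((K' + 1 : ℕ) : ℤ) = (K' : ℤ) + 1 := by push_cast; ring
  have hcastR : ((K' + 1 : ℕ) : ℝ) = (K' : ℝ) + 1 := by push_cast; ring
  have ha₀ : ∀ u ∈ Icc (0 : ℝ) s, |X 1 (K' : ℤ) u| ≤ A * (1 + ε₀) ^ (-(θ * (K' : ℝ))) :=
    fun u hu => habs u hu K' 1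
  have ha₁x : ∀ u ∈ Icc (0 : ℝ) s, |X 0 ((K' : ℤ) + 1) u| ≤ A * (1 + ε₀) ^ (-(θ * ((K' : ℝ) + 1))) :=
    fun u hu => by rw [← hcast, ← hcastR]; exact habs u hu (K' + 1) 0
  have ha₁z : ∀ u ∈ Icc (0 : ℝ) s, |X 2 ((K' : ℤ) + 1) u| ≤ A * (1 + ε₀) ^ (-(θ * ((K' : ℝ) + 1))) :=
    fun u hu => by rw [← hcast, ← hcastR]; exact habs u hu (K' + 1) 2
  -- block bound `E_max`, empty side/pocket at time 0
  have hE : ∀ u ∈ Icc (0 : ℝ) s, ∑ k ∈ Finset.range (K' + 1), ∑ i : Fin 4,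
      (1 / 2 : ℝ) * X i (k : ℤ) u ^ 2 ≤ Emax := by
    intro u hu
    calc ∑ k ∈ Finset.range (K' + 1), ∑ i : Fin 4, (1 / 2 : ℝ) * X i (k : ℤ) u ^ 2
        ≤ ∑ k ∈ Finset.range (K' + 1), C * E₀ := Finset.sum_le_sum fun k _ =>
          (hshell u hu k).trans (mul_le_of_le_one_right (by positivity)
            (Real.rpow_le_one_of_one_le_of_nonpos hb1.le (by
              have : (0 : ℝ) ≤ k := Nat.cast_nonneg k
              nlinarith)))
      _ = Emax := by simp [hEmaxdef, Finset.sum_const, Finset.card_range]; ring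
  have h10 : X 1 (K' : ℤ) 0 = 0 := by rw [hinit, if_neg (by exact_mod_cast (by omega : K' ≠ 0))]
  have h20 : X 2 ((K' : ℤ) + 1) 0 = 0 := by rw [hinit, if_neg (by omega)]
  have hss : s ∈ Icc (0 : ℝ) s := ⟨hs.le, le_rfl⟩
  have hδ : (0 : ℝ) < (1 + ε₀) ^ (-((1 + θ) * (K' : ℝ))) := Real.rpow_pos_of_pos hb _
  -- metering at the bond `K'` (lemmas of record)
  have hmain := sideBranch_noEscape_abstract hε hν hlow hcont hder K' h10 h20 hδ hss ha₀ ha₁x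
    ha₁z hE hνt
  have hrate := sideBranch_noEscape_rate hε hν1 hθ hA0 hs.le hsT K'
  dsimp only at hrate
  -- the block starts with all the energy
  have hB0 : (∑ k ∈ Finset.range (K' + 1), ∑ i : Fin 4, (1 / 2 : ℝ) * X i (k : ℤ) 0 ^ 2) = E₀ := by
    rw [Finset.sum_range_succ']
    have h1 : ∀ k : ℕ, (∑ i : Fin 4, (1 / 2 : ℝ) * X i ((k + 1 : ℕ) : ℤ) 0 ^ 2) = 0 := fun k =>
      Finset.sum_eq_zero fun i _ => by
        rw [hinit, if_neg (by push_cast; omega)]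
        ring
    simp only [h1, Finset.sum_const_zero, zero_add]
    refine Finset.sum_congr rfl fun i _ => ?_
    rw [hinit, if_pos (by simp)]
  rw [hB0] at hmain
  linarith

end Solution

/-- Exponent bookkeeping for the tail between `K+1` and `K'`: if `C·r^K ≤ c/4` with
`r = b^{-(2θ-1)}`, then `C E₀ b^{-2θ(K+1)} ≤ (c/4) E₀ b^{-K}` (`θ ≥ 0`, `b = 1+ε₀ ≥ 1`). [this file] -/
theorem sideBranch_ceilingTail_le_quarter {ε₀ θ C c E₀ : ℝ} (hε : 0 < ε₀) (hθ : 0 ≤ θ) (hC : 0 ≤ C)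
    (hE₀ : 0 ≤ E₀) (K : ℕ) (hCK : C * ((1 + ε₀) ^ (-(2 * θ - 1))) ^ K ≤ c / 4) :
    C * E₀ * (1 + ε₀) ^ (-(2 * θ * ((K + 1 : ℕ) : ℝ))) ≤ c / 4 * E₀ * (1 + ε₀) ^ (-(K : ℝ)) := by
  have hb : (0 : ℝ) < 1 + ε₀ := by linarith
  have hb1 : (1 : ℝ) ≤ 1 + ε₀ := by linarith
  have hexp : (1 + ε₀) ^ (-(2 * θ * ((K + 1 : ℕ) : ℝ))) ≤ (1 + ε₀) ^ (-(2 * θ * (K : ℝ))) := by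
    apply Real.rpow_le_rpow_of_exponent_le hb1
    have hk : (0 : ℝ) ≤ (K : ℝ) := Nat.cast_nonneg K
    push_cast
    nlinarith
  have hrK : ((1 + ε₀) ^ (-(2 * θ - 1))) ^ K * (1 + ε₀) ^ (-(K : ℝ)) =
      (1 + ε₀) ^ (-(2 * θ * (K : ℝ))) := by
    rw [← Real.rpow_mul_natCast hb.le, ← Real.rpow_add hb]
    congr 1
    ring
  have hpos : 0 ≤ E₀ * (1 + ε₀) ^ (-(K : ℝ)) := mul_nonneg hE₀ (Real.rpow_nonneg hb.le _)
  calc C * E₀ * (1 + ε₀) ^ (-(2 * θ * ((K + 1 : ℕ) : ℝ)))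
      ≤ C * E₀ * (1 + ε₀) ^ (-(2 * θ * (K : ℝ))) := mul_le_mul_of_nonneg_left hexp (by positivity)
    _ = (C * ((1 + ε₀) ^ (-(2 * θ - 1))) ^ K) * (E₀ * (1 + ε₀) ^ (-(K : ℝ))) := by
        rw [← hrK]; ring
    _ ≤ (c / 4) * (E₀ * (1 + ε₀) ^ (-(K : ℝ))) := mul_le_mul_of_nonneg_right hCK hpos
    _ = c / 4 * E₀ * (1 + ε₀) ^ (-(K : ℝ)) := by ring

/-- Splitting a block sum: shells `0..K'` = shells `0..K` + shells `K+1..K'` (`K+1 ≤ K'`). [folklore] -/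
theorem sideBranch_sum_range_split (F : ℕ → ℝ) {K K' : ℕ} (h : K + 1 ≤ K') :
    (∑ k ∈ Finset.range (K' + 1), F k) =
      (∑ k ∈ Finset.range (K + 1), F k) + ∑ k ∈ Finset.Icc (K + 1) K', F k := by
  rw [Finset.range_eq_Ico, Finset.range_eq_Ico, ← Finset.Ico_add_one_right_eq_Icc,
    Finset.sum_Ico_consecutive F (Nat.zero_le _) (by omega : K + 1 ≤ K' + 1)]

/-- **`SideBranchCriticalEscapeEstimateAt ε₀ → ¬ CeilingAt 10 ε₀ α_SB`.**  Under the tail ceiling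
with exponent `θ > 1/2` and constant `C`: choose a depth `K` of the estimate with
`C·b^{-(2θ-1)K} < c/4`; the tail between `K+1` and any `K'` is `≤ C E₀ b^{-2θ(K+1)} ≤ (c/4)E₀b^{-K}`;
choose `K' ≥ K+1` with `Φ₁(C,θ,T)·b^{-(θ-1/2)K'} < (c/4)E₀b^{-K}` (metering of record at the bond
`K'`) and then `ν` below the estimate's threshold with block dissipation `2ν_{K'}E_max T ≤ (c/4)E₀b^{-K}`;
the ceiling supplies a global regular solution at that `ν` (engine of record), clamped to the
estimate's window `[0,s]`: its block `0..K` has lost `< (3c/4)E₀b^{-K}`, contradicting the estimate.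
MODEL lattice only. [this file] -/
theorem not_ceilingAt_sideBranch_of_criticalEscapeEstimate {ε₀ : ℝ} (hε : 0 < ε₀)
    (hH : SideBranchCriticalEscapeEstimateAt ε₀) : ¬ CeilingAt 10 ε₀ sideBranchTable := by
  intro hCeil
  obtain ⟨θ, hθ, C, hC, hceil⟩ := hCeil sideBranchTable_inTableClass sideBranchTable_orthant
  obtain ⟨c, hc, hfam⟩ := hH
  have hb : (0 : ℝ) < 1 + ε₀ := by linarith
  have hb1 : (1 : ℝ) < 1 + ε₀ := by linarith
  -- Step 1: the depth `K` of the estimate, with `C · r^K < c/4`, `r = b^{-(2θ-1)} < 1`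
  set r : ℝ := (1 + ε₀) ^ (-(2 * θ - 1)) with hrdef
  have hr0 : 0 ≤ r := Real.rpow_nonneg hb.le _
  have hr1 : r < 1 := Real.rpow_lt_one_of_one_lt_of_neg hb1 (by linarith)
  have hc4 : 0 < c / 4 := by positivity
  have htendr : Tendsto (fun K : ℕ => C * r ^ K) atTop (𝓝 (C * 0)) :=
    (tendsto_pow_atTop_nhds_zero_of_lt_one hr0 hr1).const_mul C
  rw [mul_zero] at htendr
  obtain ⟨K₀, hK₀⟩ := Filter.eventually_atTop.1 (htendr.eventually (gt_mem_nhds hc4))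
  obtain ⟨K, hKK₀, X₀, hE₀, T, hT, ν₀, hν₀, hν⟩ := hfam K₀
  have hCK : C * r ^ K < c / 4 := hK₀ K hKK₀
  set E₀ : ℝ := ∑ i : Fin 4, (1 / 2 : ℝ) * X₀ i ^ 2 with hE₀def
  have hE₀0 : 0 ≤ E₀ := hE₀.le
  -- the quarter of the claimed escape
  set w : ℝ := c / 4 * E₀ * (1 + ε₀) ^ (-(K : ℝ)) with hwdef
  have hbK : 0 < (1 + ε₀) ^ (-(K : ℝ)) := Real.rpow_pos_of_pos hb _
  have hw : 0 < w := by positivity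
  -- Step 2: the deeper bond `K'` with `Φ₁ q^{K'} < w`, `q = b^{-(θ-1/2)} < 1`
  set A : ℝ := Real.sqrt (2 * C * E₀) with hAdef
  set Φ₁ : ℝ := (5 + T / 2 + 25 * Real.exp 1 / 2 + Real.exp 1) * A ^ 2 +
    5 * Real.exp 1 / 2 * A ^ 3 + 5 * T / 2 * A with hΦ₁def
  set q : ℝ := (1 + ε₀) ^ (-(θ - 1 / 2)) with hqdef
  have hq0 : 0 ≤ q := Real.rpow_nonneg hb.le _
  have hq1 : q < 1 := Real.rpow_lt_one_of_one_lt_of_neg hb1 (by linarith)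
  have htend : Tendsto (fun K' : ℕ => Φ₁ * q ^ K') atTop (𝓝 (Φ₁ * 0)) :=
    (tendsto_pow_atTop_nhds_zero_of_lt_one hq0 hq1).const_mul Φ₁
  rw [mul_zero] at htend
  obtain ⟨K', hK'small, hK'ge⟩ := ((htend.eventually (gt_mem_nhds hw)).and
    (eventually_ge_atTop (K + 1))).exists
  have hqK' : (1 + ε₀) ^ (-((θ - 1 / 2) * (K' : ℝ))) = q ^ K' := by
    rw [show -((θ - 1 / 2) * (K' : ℝ)) = (-(θ - 1 / 2)) * (K' : ℝ) by ring,
      Real.rpow_mul_natCast hb.le]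
  -- Step 3: the viscosity
  set Emax : ℝ := C * E₀ * ((K' : ℝ) + 1) with hEmaxdef
  have hEmax0 : 0 ≤ Emax := by positivity
  set D : ℝ := 2 * (1 + ε₀) ^ ((2 : ℝ) * (K' : ℝ)) * Emax * T + 1 with hDdef
  have hD0 : 0 < D := by positivity
  set ν₁ : ℝ := min ν₀ (min 1 (min (1 / ((1 + ε₀) ^ ((2 : ℝ) * ((K' : ℝ) + 1)) * T)) (w / D)))
    with hν₁def
  have hν₁ : 0 < ν₁ := lt_min hν₀ (lt_min one_pos (lt_min (by positivity) (by positivity)))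
  have hν₁0 : ν₁ ≤ ν₀ := min_le_left _ _
  have hν11 : ν₁ ≤ 1 := (min_le_right _ _).trans (min_le_left _ _)
  have hν12 : ν₁ ≤ 1 / ((1 + ε₀) ^ ((2 : ℝ) * ((K' : ℝ) + 1)) * T) :=
    (min_le_right _ _).trans ((min_le_right _ _).trans (min_le_left _ _))
  have hν13 : ν₁ ≤ w / D := (min_le_right _ _).trans ((min_le_right _ _).trans (min_le_right _ _))
  obtain ⟨s, hs, hsT, hall⟩ := hν ν₁ hν₁ hν₁0
  -- Step 4: a global regular solution at viscosity `ν₁` (free under the ceiling), clamped to `[0,s]`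
  obtain ⟨Xg, hXg⟩ := sideBranch_viscousGlobal_of_ceilingAt hε hCeil ν₁ hν₁ X₀
  obtain ⟨hinit, hlow, hbd, hcont, hder⟩ := viscousGlobal_window hXg hs
  have hloss := hall _ hinit hlow hbd hcont hder
  -- cone invariance (item 25508, proved): non-negative on shells `≥ 1`
  have hpos := orthantInvariance_proof ε₀ ν₁ hε hν₁ sideBranchTable sideBranchTable_orthant X₀ s hs _
    hinit hlow hbd hcont hder
  -- the ceiling along the solution: tail form and per-shell form
  have htail := fun (u : ℝ) (hu : u ∈ Icc (0 : ℝ) s) (n N : ℕ) (hnN : n ≤ N) =>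
    hceil ν₁ hν₁ X₀ s hs _ hinit hlow hbd hcont hder hpos n N hnN u hu
  have hshell : ∀ u ∈ Icc (0 : ℝ) s, ∀ k : ℕ,
      ∑ i : Fin 4, (1 / 2 : ℝ) * Xg i (k : ℤ) (max 0 (min u s)) ^ 2 ≤
        C * (∑ i : Fin 4, (1 / 2 : ℝ) * X₀ i ^ 2) * (1 + ε₀) ^ (-(2 * θ * (k : ℝ))) := by
    intro u hu k
    have h := htail u hu k k le_rfl
    rw [Finset.Icc_self, Finset.sum_singleton] at h
    exact h
  -- Step 5: the loss of the deep block `0..K'` (metering of record)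
  have hss : s ∈ Icc (0 : ℝ) s := ⟨hs.le, le_rfl⟩
  have hK'1 : 1 ≤ K' := le_trans (by omega) hK'ge
  have hP0 : 0 < (1 + ε₀) ^ ((2 : ℝ) * ((K' : ℝ) + 1)) * T := by positivity
  have hνt : ν₁ * (1 + ε₀) ^ ((2 : ℝ) * ((K' : ℝ) + 1)) * s ≤ 1 := by
    calc ν₁ * (1 + ε₀) ^ ((2 : ℝ) * ((K' : ℝ) + 1)) * s
        ≤ ν₁ * (1 + ε₀) ^ ((2 : ℝ) * ((K' : ℝ) + 1)) * T := by gcongr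
      _ ≤ 1 / ((1 + ε₀) ^ ((2 : ℝ) * ((K' : ℝ) + 1)) * T) *
            (1 + ε₀) ^ ((2 : ℝ) * ((K' : ℝ) + 1)) * T := by gcongr
      _ = 1 := by field_simp
  have hdeep := sideBranch_deepBlockLoss_le_of_shellCeiling hε hν₁.le hν11 hθ hC hinit hlow hcont hder
    hs hsT hshell K' hK'1 hνt
  rw [← hE₀def, ← hAdef, ← hΦ₁def, hqK', ← hEmaxdef] at hdeep
  -- dissipation of the deep block: `2 ν_{K'} E_max s ≤ w`
  have hdiss : 2 * (ν₁ * (1 + ε₀) ^ ((2 : ℝ) * (K' : ℝ))) * Emax * s ≤ w := by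
    have h1 : 2 * (ν₁ * (1 + ε₀) ^ ((2 : ℝ) * (K' : ℝ))) * Emax * s ≤
        2 * ((w / D) * (1 + ε₀) ^ ((2 : ℝ) * (K' : ℝ))) * Emax * T := by gcongr
    have h2 : 2 * ((w / D) * (1 + ε₀) ^ ((2 : ℝ) * (K' : ℝ))) * Emax * T =
        w * ((2 * (1 + ε₀) ^ ((2 : ℝ) * (K' : ℝ)) * Emax * T) / D) := by
      field_simp
    have h3 : (2 * (1 + ε₀) ^ ((2 : ℝ) * (K' : ℝ)) * Emax * T) / D ≤ 1 := by
      rw [div_le_one hD0, hDdef]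
      linarith
    have h4 : w * ((2 * (1 + ε₀) ^ ((2 : ℝ) * (K' : ℝ)) * Emax * T) / D) ≤ w :=
      mul_le_of_le_one_right hw.le h3
    linarith
  -- Step 6: the tail between `K+1` and `K'` under the ceiling: `≤ C E₀ b^{-2θ(K+1)} ≤ w`
  have hmid : ∑ k ∈ Finset.Icc (K + 1) K', ∑ i : Fin 4,
      (1 / 2 : ℝ) * Xg i (k : ℤ) (max 0 (min s s)) ^ 2 ≤ w :=
    (htail s hss (K + 1) K' hK'ge).trans
      (sideBranch_ceilingTail_le_quarter hε (by linarith) hC hE₀0 K hCK.le)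
  -- Step 7: split the deep block and compare with the claimed escape `4w`
  rw [sideBranch_sum_range_split _ hK'ge] at hdeep
  have hclaim : (1 - c * (1 + ε₀) ^ (-(K : ℝ))) * E₀ = E₀ - 4 * w := by rw [hwdef]; ring
  rw [hclaim] at hloss
  linarith

/-! ## §3 The conditional refutation of the crux by name -/

/-- **Negative lemma (conditional refutation of the crux BY NAME, Onsager-critical form).**
`SideBranchCriticalEscapeEstimate → ¬ OrthantTailCeiling`: the crux quantifies over all spreads
`R ≥ 1`, all `ε₀ ∈ (0,1]` and all orthant tables of `E₂(R)`; `α_SB ∈ E₂(10)` is orthant, and at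
`(10, ε₀, α_SB)` its body is refuted by `not_ceilingAt_sideBranch_of_criticalEscapeEstimate`.
MODEL lattice only; conditional; settles nothing by itself. [this file] -/
theorem orthantTailCeiling_false_of_sideBranchCriticalEscapeEstimate
    (hH : SideBranchCriticalEscapeEstimate) : ¬ OrthantTailCeiling := by
  obtain ⟨ε₀, hε, hε1, hHε⟩ := hH
  intro hOTC
  rw [orthantTailCeiling_iff_ceilingAt] at hOTC
  exact not_ceilingAt_sideBranch_of_criticalEscapeEstimate hε hHε
    (hOTC 10 (by norm_num) ε₀ hε hε1 sideBranchTable)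

/-- Gate-shaped alias (`<Decl>_false_of_<H>`): `SideBranchCriticalEscapeEstimate → ¬ OrthantTailCeiling`.
MODEL lattice only; conditional; settles nothing by itself. [this file] -/
theorem OrthantTailCeiling_false_of_SideBranchCriticalEscapeEstimate :
    SideBranchCriticalEscapeEstimate → ¬ OrthantTailCeiling :=
  orthantTailCeiling_false_of_sideBranchCriticalEscapeEstimate

end Summit.NavierStokesRegularity.NavierStokesRegularity.Theorems.SubOnsagerCeiling

end
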